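import Mathlib.Analysis.InnerProductSpace.PiL2
import Mathlib.Analysis.Convex.Exposed
import Literature.Geometry.DiscreteGeometry.KissingDelaunay
import Literature.Geometry.DiscreteGeometry.SphericalCodeContactGraph
import HarnessLib

/-!
# Contact edges of a spherical code are edges of its convex hull — proved

Topic `Literature/Geometry/DiscreteGeometry`; a small brick of the Musin–Tarasov programme
(`SphericalCodeContactGraph.lean` …; named fact `musinTarasov2012_tammes_thirteen`), recording the
polytope reading of the contact graph `CG(X)` of a finite `X ⊂ S^{n−1}`: every point of `X` is a
vertex of the polytope `conv X`, and every contact edge `{u, v}` (`⟪u, v⟫ = cos ψ(X)`, the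
largest inner product among distinct points) spans an EXPOSED EDGE `[u, v]` of `conv X` — exposed
by the hyperplane `⟪u + v, ·⟫ = 1 + cos ψ`, which passes through `u, v` and leaves every other
point of `X` strictly on the origin's side since `⟪u + v, s⟫ ≤ 2 cos ψ < 1 + cos ψ`.  So `CG(X)`
is a subgraph of the `1`-skeleton of `conv X` (whose boundary complex is the spherical Delaunay
subdivision of `X`); this is the entrance to the face structure used from Proposition 3.4 on.
The kissing case (`S²(2)`, contact distance `2`, Hales 2012) is `isExposed_convexHull_segment` of
`KissingDelaunay.lean`, whose Part A (faces of a polytope cut out by a functional) is reused.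
Everything is PROVED; no named facts; any real inner product space.

## References

* O. R. Musin, A. S. Tarasov, Discrete Comput. Geom. 48 (2012) 128–141, §2.1 (contact graphs),
  §3 (faces of `CG(X)`). [`MusinTarasov2012`]
* T. C. Hales, arXiv:1209.6043 (2012), proof of Theorem 2 ("each edge of `E⁺(V′)` is an edge of
  this polyhedron") — the kissing case. [`Hales2012`]
-/

noncomputable section

namespace Literature.Geometry.DiscreteGeometry

open RealInnerProductSpace

variable {E : Type*} [NormedAddCommGroup E] [InnerProductSpace ℝ E] {S : Set E}

/-- **Every point of a finite set of unit vectors is a vertex (exposed point) of its convex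
hull**, exposed by the tangent functional `⟪x, ·⟫` (`= 1` at `x`, `< 1` at every other unit
vector). [folklore] -/
theorem mem_exposedPoints_convexHull_of_unit (hfin : S.Finite) (hn : ∀ s ∈ S, ‖s‖ = 1) {x : E}
    (hx : x ∈ S) : x ∈ (convexHull ℝ S).exposedPoints ℝ := by
  refine ⟨subset_convexHull ℝ S hx, innerSL ℝ x, fun y hy => ?_⟩
  have hM : ∀ s ∈ S, (innerSL ℝ x : E →ₗ[ℝ] ℝ) s ≤ 1 := fun s hs => by
    have := real_inner_le_norm x s
    rw [hn x hx, hn s hs, one_mul] at this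
    simpa [innerSL_apply_apply] using this
  have hxx : innerSL ℝ x x = 1 := by
    rw [innerSL_apply_apply, real_inner_self_eq_norm_sq, hn x hx]; norm_num
  refine ⟨?_, fun hle => ?_⟩
  · rw [hxx]
    exact forall_convexHull_le_of_forall_le _ hM y hy
  · rw [hxx] at hle
    have hy' := mem_convexHull_sep_eq_of_le _ hfin hM hy hle
    have hsing : {s ∈ S | (innerSL ℝ x : E →ₗ[ℝ] ℝ) s = 1} = {x} := by
      ext s
      simp only [Set.mem_setOf_eq, Set.mem_singleton_iff, ContinuousLinearMap.coe_coe,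
        innerSL_apply_apply]
      constructor
      · rintro ⟨hs, h1⟩
        exact ((inner_eq_one_iff_of_norm_eq_one (hn x hx) (hn s hs)).1 h1).symm
      · rintro rfl
        refine ⟨hx, ?_⟩
        rw [real_inner_self_eq_norm_sq, hn s hx]; norm_num
    rw [hsing, convexHull_singleton] at hy'
    exact hy'

/-- The supporting functional of a contact edge: `⟪u + v, s⟫ < ⟪u + v, u⟫ = 1 + κ` whenever
`⟪u, s⟫, ⟪v, s⟫ ≤ κ = ⟪u, v⟫` (`u ≠ v` unit, so `κ < 1`). [folklore] -/
theorem inner_add_lt_of_contact {u v s : E} (hu : ‖u‖ = 1) (hv : ‖v‖ = 1) (hne : u ≠ v)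
    {κ : ℝ} (huv : ⟪u, v⟫ = κ) (hus : ⟪u, s⟫ ≤ κ) (hvs : ⟪v, s⟫ ≤ κ) :
    ⟪u + v, s⟫ < ⟪u + v, u⟫ := by
  have hκ : κ < 1 := huv ▸ inner_lt_one_of_ne_unit hu hv hne
  have huu : ⟪u, u⟫ = 1 := by rw [real_inner_self_eq_norm_sq, hu]; norm_num
  rw [inner_add_left, inner_add_left, huu, real_inner_comm u v, huv]
  linarith

/-- `⟪u + v, u⟫ = ⟪u + v, v⟫ (= 1 + ⟪u, v⟫)` for unit vectors. [folklore] -/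
theorem inner_add_left_eq_inner_add_right_of_unit {u v : E} (hu : ‖u‖ = 1) (hv : ‖v‖ = 1) :
    ⟪u + v, u⟫ = ⟪u + v, v⟫ := by
  have huu : ⟪u, u⟫ = 1 := by rw [real_inner_self_eq_norm_sq, hu]; norm_num
  have hvv : ⟪v, v⟫ = 1 := by rw [real_inner_self_eq_norm_sq, hv]; norm_num
  rw [inner_add_left, inner_add_left, huu, hvv, real_inner_comm u v]; ring

/-- **The face of `conv S` cut out by `⟪u + v, ·⟫` is the segment `[u, v]`** for a contact edge
`{u, v}` of a finite spherical code `S` (unit vectors, pairwise inner products `≤ κ`,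
`⟪u, v⟫ = κ`, `u ≠ v`). [folklore] -/
theorem toExposed_innerSL_add_convexHull_of_contact (hfin : S.Finite) (hn : ∀ s ∈ S, ‖s‖ = 1)
    {κ : ℝ} (hS : ∀ s ∈ S, ∀ t ∈ S, s ≠ t → ⟪s, t⟫ ≤ κ) {u v : E} (hu : u ∈ S) (hv : v ∈ S)
    (hne : u ≠ v) (huv : ⟪u, v⟫ = κ) :
    (innerSL ℝ (u + v)).toExposed (convexHull ℝ S) = segment ℝ u v := by
  set l : E →L[ℝ] ℝ := innerSL ℝ (u + v) with hl
  have hlt : ∀ s ∈ S, s ≠ u → s ≠ v → l s < l u := by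
    intro s hs hsu hsv
    simp only [hl, innerSL_apply_apply]
    exact inner_add_lt_of_contact (hn u hu) (hn v hv) hne huv
      (hS u hu s hs (Ne.symm hsu)) (hS v hv s hs (Ne.symm hsv))
  have hluv : l v = l u := by
    simp only [hl, innerSL_apply_apply]
    exact (inner_add_left_eq_inner_add_right_of_unit (hn u hu) (hn v hv)).symm
  have hM : ∀ s ∈ S, (l : E →ₗ[ℝ] ℝ) s ≤ l u := by
    intro s hs
    simp only [ContinuousLinearMap.coe_coe]
    by_cases hsu : s = u
    · rw [hsu]
    by_cases hsv : s = v
    · rw [hsv, hluv]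
    exact (hlt s hs hsu hsv).le
  have hhull : ∀ y ∈ convexHull ℝ S, l y ≤ l u := forall_convexHull_le_of_forall_le _ hM
  have hpair : {s ∈ S | (l : E →ₗ[ℝ] ℝ) s = l u} = {u, v} := by
    ext s
    simp only [Set.mem_setOf_eq, Set.mem_insert_iff, Set.mem_singleton_iff,
      ContinuousLinearMap.coe_coe]
    constructor
    · rintro ⟨hs, he⟩
      by_contra h
      push Not at h
      exact absurd he (ne_of_lt (hlt s hs h.1 h.2))
    · rintro (rfl | rfl)
      · exact ⟨hu, rfl⟩
      · exact ⟨hv, hluv⟩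
  ext x
  simp only [ContinuousLinearMap.toExposed, Set.mem_setOf_eq]
  constructor
  · rintro ⟨hx, hmax⟩
    have hle : l u ≤ l x := hmax u (subset_convexHull ℝ S hu)
    have hx' := mem_convexHull_sep_eq_of_le _ hfin hM hx hle
    rw [hpair, convexHull_pair] at hx'
    exact hx'
  · intro hx
    refine ⟨segment_subset_convexHull hu hv hx, fun y hy => ?_⟩
    obtain ⟨p, q, hp0, hq0, hpq, rfl⟩ := hx
    have h1 : l (p • u + q • v) = l u := by
      rw [map_add, map_smul, map_smul, hluv, smul_eq_mul, smul_eq_mul, ← add_mul, hpq, one_mul]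
    rw [h1]
    exact hhull y hy

/-- **Contact edges are exposed edges of the convex hull.**  Let `S` be a finite set of unit
vectors with pairwise inner products `≤ κ` and `u ≠ v ∈ S` with `⟪u, v⟫ = κ` (an edge of the
contact graph `codeContactGraph S κ` = `CG(S)` when `κ = cos ψ(S)`).  Then the segment `[u, v]`
is an exposed face of the polytope `conv S`: the contact graph lies in the `1`-skeleton of
`conv S`. [folklore] -/
theorem isExposed_convexHull_segment_of_contact (hfin : S.Finite) (hn : ∀ s ∈ S, ‖s‖ = 1)
    {κ : ℝ} (hS : ∀ s ∈ S, ∀ t ∈ S, s ≠ t → ⟪s, t⟫ ≤ κ) {u v : E} (hu : u ∈ S) (hv : v ∈ S)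
    (hne : u ≠ v) (huv : ⟪u, v⟫ = κ) : IsExposed ℝ (convexHull ℝ S) (segment ℝ u v) := fun _ =>
  ⟨innerSL ℝ (u + v), (toExposed_innerSL_add_convexHull_of_contact hfin hn hS hu hv hne huv).symm⟩

/-- Graph form: every edge of `codeContactGraph S κ` spans an exposed edge of `conv S`.
[folklore] -/
theorem isExposed_convexHull_segment_of_codeContactGraph_adj (hfin : S.Finite)
    (hn : ∀ s ∈ S, ‖s‖ = 1) {κ : ℝ} (hS : ∀ s ∈ S, ∀ t ∈ S, s ≠ t → ⟪s, t⟫ ≤ κ) {x y : S}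
    (h : (codeContactGraph S κ).Adj x y) :
    IsExposed ℝ (convexHull ℝ S) (segment ℝ (x : E) y) :=
  isExposed_convexHull_segment_of_contact hfin hn hS x.2 y.2
    (fun e => h.1 (Subtype.val_injective e)) h.2

end Literature.Geometry.DiscreteGeometry

end
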